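import Summits.Ventures.LatticeQCDFlow.Scaling.SwapAcceptanceMinLaw
import Summits.Ventures.LatticeQCDFlow.Scaling.CouplingOverlap
import Summits.Ventures.LatticeQCDFlow.Scaling.WilsonTransferAcceptanceWindow

/-!
HONEST FRAMING: exact (Metropolis-corrected) sampling algorithms for lattice gauge theory; figures
of merit are autocorrelation/cost numbers at stated couplings and volumes; no continuum-physics
claim.

# SwapAcceptanceOverlap — THE HISTOGRAM-OVERLAP LAW OF THE SWAP ACCEPTANCE, EXACT AND TWO-SIDED:
# `OVL(μ_s, μ_t)² ≤ swapAcc(s, t) ≤ OVL(μ_s, μ_t)`, `OVL = E_{μ_s}[min(1, dμ_t/dμ_s)] = 1 − ‖μ_s − μ_t‖_TV`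
# (row 22 `su3-ptbc`, GEN-9, ours; sequel of GEN-8's `SwapAcceptanceMinLaw`)

Venture `LatticeQCDFlow` (cell pub-lqcd), topic `Scaling`; FANOUT row 22 (`su3-ptbc`, PTBC comparator arm E4).  NEW
WORK of the cell over GEN-8's `SwapAcceptanceMinLaw` (`swapAcc_eq_min_law`), lean-2's bounded linear family
`μ_u = μ.tilted (u·X)` (`Scaling/SwapAcceptanceLaw`: `swapAcc`, `integral_exp_mul_tilted`, `integrable_exp_mul_of_bounded`,
`integrable_of_abs_le`, `isProbabilityMeasure_tilted_mul`, `mgf_pos_of_bounded`), lean-2's OVERLAP LAW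
`Scaling/CouplingOverlap` (the overlap `∫ min(p_s, p_t) dμ` of two family members, `p_u = e^{uX}/mgf(u)`, `= 1 − TV(μ_s, μ_t)`
by `overlap_eq_one_sub_half_integral_abs`, with its variance floor/ceiling bounds) and `Theory2.swapAcc_symm`
(`Scaling/WilsonTransferAcceptanceWindow`); Mathlib `integral_prod`, `Integrable.integral_prod_left`, `integral_tilted`,
`integral_mono_of_nonneg`.  Nothing is cited as a fact; no numerics of a run; NO definition is introduced (the density
of `μ_t` against `μ_s` along `X` is written out as `w = e^{(t−s)X}/E_{μ_s}[e^{(t−s)X}]`).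

## What is proved (`μ` a probability measure, `X` bounded measurable; `OVL := ∫ min(p_s, p_t) dμ = E_{μ_s}[min(1, w)]`)

* `swapAcc_eq_integral_integral_min_density` (`s ≤ t`) — `swapAcc X μ s t = ∫∫ min(w x, w y) dμ_s dμ_s` (the min law
  with `e^{h·min(a,b)} = min(e^{ha}, e^{hb})`; the measure-level form of row 11's finite `acc = E_{q⊗q} min(w, w′)`).
* **`swapAcc_le_overlap`** — `swapAcc(s,t) ≤ E_{μ_s}[min(1, w)]`: the inner integral `∫ min(w x, w y) dμ_s(y)` is at
  most `min(w x, ∫ w) = min(w x, 1)` (the measure-level form, for the swap, of theory-2's finite `acc ≤ 1 − TV`).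
* **`overlap_sq_le_swapAcc`** — `E_{μ_s}[min(1, w)]² ≤ swapAcc(s,t)`: pointwise `min(1, a)·min(1, b) ≤ min(a, b)` for
  `a, b ≥ 0` and independence of the two copies.  Since `OVL² = (1 − TV)² = 1 − 2·TV + TV²`, this floor IMPROVES the
  single-law Le Cam floor `1 − 2·TV` (theory-2's `one_sub_two_tvDist_le_accRate`, finite spaces) by `TV²`.
* **`overlap_mem_Icc_swapAcc`** — read for a run: `OVL ∈ [swapAcc, √swapAcc]`; at the card's `20 %` target the adjacent
  replicas' defect-action laws overlap between `0.20` and `0.447`, at `25 %` between `0.25` and `0.5`.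
* `integral_min_one_density_eq_overlap` — the BRIDGE `E_{μ_s}[min(1, w)] = ∫ min(p_s, p_t) dμ` to lean-2's overlap, and
  **`overlap_sq_le_swapAcc_le_overlap`** / **`…'`** — the sandwich `OVL² ≤ swapAcc X μ s t ≤ OVL` in lean-2's vocabulary,
  for `s ≤ t` and for `t ≤ s`.
(Composing with `CouplingOverlap`'s variance bounds only reproduces WEAKER forms of lean-2's `SwapAcceptanceLadder`
floor/ceiling `exp(−(δ√(2M) + Mδ²)) ≤ swapAcc ≤ exp(−mδ²/4)`, so no such corollary is stated.)

WHY (CARD-su3-ptbc §1.6 / §3).  The classical tuning heuristic for replica ladders is "neighbouring energy histograms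
must overlap"; the card tunes on the acceptance itself.  This file makes the two interchangeable up to a square root,
exactly and model-free: a pair accepts at least the SQUARE of its histogram overlap and at most the overlap.  Like the
min law, `OVL = E_{μ_s}[min(1, w)]` is a one-replica quantity (`w` is explicit in the defect action), so a pilot run at
`c_i` bounds the acceptance with any prospective partner from both sides before the partner is simulated (report-only
option for a successor; no recipe byte changes).  Desk check in the Gaussian shift model (NOT certified):
`swapAcc = erfc(σh/2)`, `OVL = erfc(σh/(2√2))`; at `σh = 2`: `0.157 ∈ [0.317², 0.317] = [0.10, 0.32]`.

Literature grade (cell rule): KNOWN MECHANISM (acceptance governed by the overlap of neighbouring energy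
distributions — Hukushima–Nemoto 1996, Kofke 2002, Predescu–Predescu–Ciobanu 2004, Katzgraber–Trebst–Huse–Troyer 2006;
`acc ≤ 1 − TV` is theory-2's T2-X in this tree, the overlap law itself is lean-2's), NEW TYPING (the exact two-sided
sandwich `OVL² ≤ acc ≤ OVL` at measure level for every bounded linear family; the `TV²` improvement of the Le Cam floor).
presearch (corpus hybrid «replica exchange acceptance probability bounded by overlap of energy distributions of neighboring
replicas» → Tuckerman 2023 pp.324–326, Thijssen 2007 p.305, Contucci–Giardinà 2012 p.44, Berg 2004 p.240: heuristic
statements only; no two-sided bound found).  NOT CLAIMED: sharpness of either side; anything about a run.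
-/

noncomputable section

open MeasureTheory ProbabilityTheory Real Set

namespace Summit.Ventures.LatticeQCDFlow.Scaling

variable {Ω : Type*} [MeasurableSpace Ω] {μ : Measure Ω} [IsProbabilityMeasure μ] {X : Ω → ℝ}

/-- `min(e^{a}, e^{b}) = e^{min(a,b)}`. [folklore] -/
theorem min_exp_exp (a b : ℝ) : min (exp a) (exp b) = exp (min a b) := by
  rcases le_total a b with h | h
  · rw [min_eq_left h, min_eq_left (exp_le_exp.2 h)]
  · rw [min_eq_right h, min_eq_right (exp_le_exp.2 h)]

/-- `min(1,a)·min(1,b) ≤ min(a,b)` for `a, b ≥ 0`. [folklore] -/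
theorem min_one_mul_min_one_le_min {a b : ℝ} (ha : 0 ≤ a) (hb : 0 ≤ b) :
    min 1 a * min 1 b ≤ min a b := by
  rcases le_total a b with h | h
  · rw [min_eq_left h]
    calc min 1 a * min 1 b ≤ min 1 a * 1 :=
          mul_le_mul_of_nonneg_left (min_le_left _ _) (le_min zero_le_one ha)
      _ ≤ a := by rw [mul_one]; exact min_le_right _ _
  · rw [min_eq_right h]
    calc min 1 a * min 1 b ≤ 1 * min 1 b :=
          mul_le_mul_of_nonneg_right (min_le_left _ _) (le_min zero_le_one hb)
      _ ≤ b := by rw [one_mul]; exact min_le_right _ _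

section Overlap

variable (hXm : Measurable X) (hXb : ∃ C, ∀ ω, |X ω| ≤ C)
include hXm hXb

/-- The density of `μ_t` against `μ_s` along `X`: `w = e^{(t−s)X} / E_{μ_s}[e^{(t−s)X}]` is bounded on `Ω`
(here: by `e^{2|t−s|C}`-type constants; we only record SOME bound). [folklore] -/
theorem density_bounded (s t : ℝ) :
    ∃ B, ∀ ω, |exp ((t - s) * X ω) / ∫ ω', exp ((t - s) * X ω') ∂(μ.tilted fun ω => s * X ω)| ≤ B := by
  haveI := isProbabilityMeasure_tilted_mul (μ := μ) hXm hXb s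
  obtain ⟨C, hC⟩ := hXb
  have hr : 0 < ∫ ω', exp ((t - s) * X ω') ∂(μ.tilted fun ω => s * X ω) :=
    integral_exp_pos (integrable_exp_mul_of_bounded hXm ⟨C, hC⟩ (t - s))
  refine ⟨exp (|t - s| * C) / ∫ ω', exp ((t - s) * X ω') ∂(μ.tilted fun ω => s * X ω), fun ω => ?_⟩
  rw [abs_of_pos (div_pos (exp_pos _) hr)]
  refine div_le_div_of_nonneg_right ?_ hr.le
  rw [exp_le_exp]
  calc (t - s) * X ω ≤ |(t - s) * X ω| := le_abs_self _
    _ = |t - s| * |X ω| := abs_mul _ _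
    _ ≤ |t - s| * C := mul_le_mul_of_nonneg_left (hC ω) (abs_nonneg _)

/-- The density integrates to one: `E_{μ_s}[w] = 1`. [folklore] -/
theorem integral_density_eq_one (s t : ℝ) :
    ∫ ω, exp ((t - s) * X ω) / (∫ ω', exp ((t - s) * X ω') ∂(μ.tilted fun ω => s * X ω))
        ∂(μ.tilted fun ω => s * X ω) = 1 := by
  haveI := isProbabilityMeasure_tilted_mul (μ := μ) hXm hXb s
  have hr : 0 < ∫ ω', exp ((t - s) * X ω') ∂(μ.tilted fun ω => s * X ω) :=
    integral_exp_pos (integrable_exp_mul_of_bounded hXm hXb (t - s))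
  rw [integral_div, div_self hr.ne']

/-- **The swap acceptance as the mean pair-minimum of the density**: for `s ≤ t`,
`swapAcc X μ s t = ∫∫ min(w x, w y) dμ_s dμ_s` with `w = dμ_t/dμ_s = e^{(t−s)X}/E_{μ_s}[e^{(t−s)X}]`
(the min law with `e^{h·min(a,b)} = min(e^{ha}, e^{hb})`). [ours] -/
theorem swapAcc_eq_integral_integral_min_density {s t : ℝ} (hst : s ≤ t) :
    swapAcc X μ s t = ∫ x, ∫ y,
      min (exp ((t - s) * X x) / ∫ ω', exp ((t - s) * X ω') ∂(μ.tilted fun ω => s * X ω))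
          (exp ((t - s) * X y) / ∫ ω', exp ((t - s) * X ω') ∂(μ.tilted fun ω => s * X ω))
        ∂(μ.tilted fun ω => s * X ω) ∂(μ.tilted fun ω => s * X ω) := by
  set μs : Measure Ω := μ.tilted fun ω => s * X ω with hμs
  haveI : IsProbabilityMeasure μs := isProbabilityMeasure_tilted_mul hXm hXb s
  set r : ℝ := ∫ ω', exp ((t - s) * X ω') ∂μs with hr_def
  have hr : 0 < r := integral_exp_pos (integrable_exp_mul_of_bounded hXm hXb (t - s))
  rw [swapAcc_eq_min_law hXm hXb hst]
  have hYm : Measurable fun z : Ω × Ω => exp ((t - s) * min (X z.1) (X z.2)) :=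
    (measurable_const.mul ((hXm.comp measurable_fst).min (hXm.comp measurable_snd))).exp
  obtain ⟨C, hC⟩ := hXb
  have hYb : ∀ z : Ω × Ω, |exp ((t - s) * min (X z.1) (X z.2))| ≤ exp (|t - s| * C) := by
    intro z
    rw [abs_of_pos (exp_pos _), exp_le_exp]
    have hm : |min (X z.1) (X z.2)| ≤ C := by
      rcases min_choice (X z.1) (X z.2) with h | h <;> rw [h] <;> exact hC _
    calc (t - s) * min (X z.1) (X z.2) ≤ |(t - s) * min (X z.1) (X z.2)| := le_abs_self _
      _ = |t - s| * |min (X z.1) (X z.2)| := abs_mul _ _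
      _ ≤ |t - s| * C := mul_le_mul_of_nonneg_left hm (abs_nonneg _)
  rw [integral_prod _ (integrable_of_abs_le hYm hYb)]
  rw [← hr_def]
  have hmin : ∀ x y : Ω, min (exp ((t - s) * X x) / r) (exp ((t - s) * X y) / r)
      = exp ((t - s) * min (X x) (X y)) / r := by
    intro x y
    rw [min_div_div_right hr.le, min_exp_exp]
    rcases le_total (X x) (X y) with h | h
    · rw [min_eq_left h, min_eq_left (mul_le_mul_of_nonneg_left h (sub_nonneg.2 hst))]
    · rw [min_eq_right h, min_eq_right (mul_le_mul_of_nonneg_left h (sub_nonneg.2 hst))]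
  simp_rw [hmin, integral_div]
  rfl

/-- **UPPER OVERLAP LAW: `swapAcc(s,t) ≤ OVL(μ_s, μ_t) = E_{μ_s}[min(1, w)]`** (`s ≤ t`): the inner integral
`∫ min(w x, w y) dμ_s(y)` is at most `min(w x, ∫ w dμ_s) = min(w x, 1)`. [ours] -/
theorem swapAcc_le_overlap {s t : ℝ} (hst : s ≤ t) :
    swapAcc X μ s t ≤ ∫ x, min 1 (exp ((t - s) * X x) / ∫ ω', exp ((t - s) * X ω') ∂(μ.tilted fun ω => s * X ω))
      ∂(μ.tilted fun ω => s * X ω) := by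
  haveI := isProbabilityMeasure_tilted_mul (μ := μ) hXm hXb s
  rw [swapAcc_eq_integral_integral_min_density hXm hXb hst]
  set r : ℝ := ∫ ω', exp ((t - s) * X ω') ∂(μ.tilted fun ω => s * X ω) with hr_def
  set w : Ω → ℝ := fun ω => exp ((t - s) * X ω) / r with hw_def
  have hwm : Measurable w := ((measurable_const.mul hXm).exp).div_const r
  obtain ⟨B, hB⟩ := density_bounded (μ := μ) hXm hXb s t
  have hwB : ∀ ω, |w ω| ≤ B := hB
  have hwi : Integrable w (μ.tilted fun ω => s * X ω) := integrable_of_abs_le hwm hwB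
  have hw1 : ∫ y, w y ∂(μ.tilted fun ω => s * X ω) = 1 := integral_density_eq_one (μ := μ) hXm hXb s t
  refine integral_mono_of_nonneg (ae_of_all _ fun x => ?_) ?_ (ae_of_all _ fun x => ?_)
  · exact integral_nonneg fun y => le_min (div_nonneg (exp_pos _).le
      (integral_nonneg fun _ => (exp_pos _).le)) (div_nonneg (exp_pos _).le (integral_nonneg fun _ => (exp_pos _).le))
  · exact (integrable_const (1 : ℝ)).inf hwi
  · -- `∫ min(w x, w y) dy ≤ min(1, w x)`
    change ∫ y, min (w x) (w y) ∂(μ.tilted fun ω => s * X ω) ≤ min 1 (w x)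
    refine le_min ?_ ?_
    · calc ∫ y, min (w x) (w y) ∂(μ.tilted fun ω => s * X ω) ≤ ∫ y, w y ∂(μ.tilted fun ω => s * X ω) :=
            integral_mono_of_nonneg (ae_of_all _ fun y => le_min (by positivity) (by positivity))
              hwi (ae_of_all _ fun y => min_le_right _ _)
        _ = 1 := hw1
    · calc ∫ y, min (w x) (w y) ∂(μ.tilted fun ω => s * X ω) ≤ ∫ _y, w x ∂(μ.tilted fun ω => s * X ω) :=
            integral_mono_of_nonneg (ae_of_all _ fun y => le_min (by positivity) (by positivity))
              (integrable_const _) (ae_of_all _ fun y => min_le_left _ _)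
        _ = w x := by simp

/-- **LOWER OVERLAP LAW: `OVL(μ_s, μ_t)² ≤ swapAcc(s,t)`** (`s ≤ t`): pointwise `min(1, w x)·min(1, w y) ≤ min(w x, w y)`
and independence of the two copies. [ours] -/
theorem overlap_sq_le_swapAcc {s t : ℝ} (hst : s ≤ t) :
    (∫ x, min 1 (exp ((t - s) * X x) / ∫ ω', exp ((t - s) * X ω') ∂(μ.tilted fun ω => s * X ω))
      ∂(μ.tilted fun ω => s * X ω)) ^ 2 ≤ swapAcc X μ s t := by
  haveI := isProbabilityMeasure_tilted_mul (μ := μ) hXm hXb s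
  rw [swapAcc_eq_integral_integral_min_density hXm hXb hst]
  set r : ℝ := ∫ ω', exp ((t - s) * X ω') ∂(μ.tilted fun ω => s * X ω) with hr_def
  set w : Ω → ℝ := fun ω => exp ((t - s) * X ω) / r with hw_def
  have hr : 0 < r := integral_exp_pos (integrable_exp_mul_of_bounded hXm hXb (t - s))
  have hw0 : ∀ ω, 0 ≤ w ω := fun ω => div_nonneg (exp_pos _).le hr.le
  have hwm : Measurable w := ((measurable_const.mul hXm).exp).div_const r
  obtain ⟨B, hB⟩ := density_bounded (μ := μ) hXm hXb s t
  have hwB : ∀ ω, |w ω| ≤ B := hB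
  have hwi : Integrable w (μ.tilted fun ω => s * X ω) := integrable_of_abs_le hwm hwB
  have hmi : Integrable (fun ω => min 1 (w ω)) (μ.tilted fun ω => s * X ω) := (integrable_const (1 : ℝ)).inf hwi
  -- the square as an iterated integral of the product
  change (∫ x, min 1 (w x) ∂(μ.tilted fun ω => s * X ω)) ^ 2
    ≤ ∫ x, ∫ y, min (w x) (w y) ∂(μ.tilted fun ω => s * X ω) ∂(μ.tilted fun ω => s * X ω)
  rw [sq, ← integral_mul_const]
  simp_rw [← integral_const_mul]
  refine integral_mono_of_nonneg (ae_of_all _ fun x => ?_) ?_ (ae_of_all _ fun x => ?_)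
  · exact integral_nonneg fun y => mul_nonneg (le_min zero_le_one (hw0 x)) (le_min zero_le_one (hw0 y))
  · -- integrability of `x ↦ ∫ min(w x, w y) dy` from the bounded pair integrand
    have hFm : Measurable fun z : Ω × Ω => min (w z.1) (w z.2) :=
      (hwm.comp measurable_fst).min (hwm.comp measurable_snd)
    have hFb : ∀ z : Ω × Ω, |min (w z.1) (w z.2)| ≤ B := by
      intro z
      rcases min_choice (w z.1) (w z.2) with h | h <;> rw [h] <;> exact hwB _
    have hF : Integrable (fun z : Ω × Ω => min (w z.1) (w z.2))
        ((μ.tilted fun ω => s * X ω).prod (μ.tilted fun ω => s * X ω)) := integrable_of_abs_le hFm hFb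
    exact hF.integral_prod_left
  · exact integral_mono_of_nonneg (ae_of_all _ fun y => mul_nonneg (le_min zero_le_one (hw0 x))
      (le_min zero_le_one (hw0 y))) ((integrable_const (w x)).inf hwi)
      (ae_of_all _ fun y => min_one_mul_min_one_le_min (hw0 x) (hw0 y))

/-- **TWO-SIDED OVERLAP LAW**: `OVL² ≤ swapAcc(s,t) ≤ OVL`, i.e. the overlap of the two replicas' laws along `X` lies
in `[swapAcc, √swapAcc]` (`s ≤ t`). [ours] -/
theorem overlap_mem_Icc_swapAcc {s t : ℝ} (hst : s ≤ t) :
    (∫ x, min 1 (exp ((t - s) * X x) / ∫ ω', exp ((t - s) * X ω') ∂(μ.tilted fun ω => s * X ω))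
      ∂(μ.tilted fun ω => s * X ω)) ∈ Icc (swapAcc X μ s t) (Real.sqrt (swapAcc X μ s t)) := by
  have h1 := swapAcc_le_overlap (μ := μ) hXm hXb hst
  have h2 := overlap_sq_le_swapAcc (μ := μ) hXm hXb hst
  exact ⟨h1, Real.le_sqrt_of_sq_le h2⟩

/-- **Bridge to lean-2's overlap**: the one-replica form `E_{μ_s}[min(1, w)]` IS the overlap
`∫ min(p_s, p_t) dμ` of `Scaling/CouplingOverlap` (`p_u = e^{uX}/mgf(u)`; `p_s·min(1, w) = min(p_s, p_t)` because
`p_s·w = p_t`). [ours] -/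
theorem integral_min_one_density_eq_overlap (s t : ℝ) :
    ∫ x, min 1 (exp ((t - s) * X x) / ∫ ω', exp ((t - s) * X ω') ∂(μ.tilted fun ω => s * X ω))
        ∂(μ.tilted fun ω => s * X ω)
      = ∫ x, min (exp (s * X x) / mgf X μ s) (exp (t * X x) / mgf X μ t) ∂μ := by
  have hZs : 0 < mgf X μ s := mgf_pos_of_bounded hXm hXb s
  have hZt : 0 < mgf X μ t := mgf_pos_of_bounded hXm hXb t
  rw [integral_exp_mul_tilted, show s + (t - s) = t by ring, integral_tilted]
  rw [show (∫ ω, exp (s * X ω) ∂μ) = mgf X μ s from rfl]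
  refine integral_congr_ae (ae_of_all _ fun x => ?_)
  have hps : 0 < exp (s * X x) / mgf X μ s := div_pos (exp_pos _) hZs
  show (exp (s * X x) / mgf X μ s) • min 1 (exp ((t - s) * X x) / (mgf X μ t / mgf X μ s))
    = min (exp (s * X x) / mgf X μ s) (exp (t * X x) / mgf X μ t)
  rw [smul_eq_mul, mul_min_of_nonneg _ _ hps.le, mul_one]
  congr 1
  rw [sub_mul, exp_sub]
  field_simp

/-- **The two-sided overlap law in lean-2's vocabulary**:
`(∫ min(p_s,p_t) dμ)² ≤ swapAcc X μ s t ≤ ∫ min(p_s,p_t) dμ` for `s ≤ t`. [ours] -/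
theorem overlap_sq_le_swapAcc_le_overlap {s t : ℝ} (hst : s ≤ t) :
    (∫ x, min (exp (s * X x) / mgf X μ s) (exp (t * X x) / mgf X μ t) ∂μ) ^ 2 ≤ swapAcc X μ s t ∧
      swapAcc X μ s t ≤ ∫ x, min (exp (s * X x) / mgf X μ s) (exp (t * X x) / mgf X μ t) ∂μ := by
  rw [← integral_min_one_density_eq_overlap hXm hXb s t]
  exact ⟨overlap_sq_le_swapAcc hXm hXb hst, swapAcc_le_overlap hXm hXb hst⟩

/-- The same for `t ≤ s` (both sides are symmetric in `s, t`). [ours] -/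
theorem overlap_sq_le_swapAcc_le_overlap' {s t : ℝ} (hts : t ≤ s) :
    (∫ x, min (exp (s * X x) / mgf X μ s) (exp (t * X x) / mgf X μ t) ∂μ) ^ 2 ≤ swapAcc X μ s t ∧
      swapAcc X μ s t ≤ ∫ x, min (exp (s * X x) / mgf X μ s) (exp (t * X x) / mgf X μ t) ∂μ := by
  have h := overlap_sq_le_swapAcc_le_overlap (μ := μ) hXm hXb hts
  rw [Theory2.swapAcc_symm t s] at h
  simp_rw [min_comm (exp (t * X _) / mgf X μ t)] at h
  exact h

end Overlap

end Summit.Ventures.LatticeQCDFlow.Scaling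

end
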